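import Literature.AlgebraicGeometry.Frobenioids.Cor411AsPrinted
import Literature.AlgebraicGeometry.Frobenioids.Thm49AsPrinted
import Literature.AlgebraicGeometry.Frobenioids.Prop55Sub
import HarnessLib

/-!
# Frobenioids I, Corollary 4.11 (iv) and the compatibility clause of (iii) AS TYPED
# (`PreFrobenioidData.Cor411iv`, `PreFrobenioidData.Cor411iii_compat`), in print's generality, AT THE
# CONSTRUCTIONS — no hypothesis on the base categories (FACT-LIST rows F-1029, F-1028)

Mochizuki, *The geometry of Frobenioids I: the general theory*, Kyushu J. Math. **62** (2008)
293–400, kurims text: Cor. 4.11 (iv) p. 92 "Suppose further that `C₁`, `C₂` are of rationally standard type.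
Then [there is] a 1-commutative diagram `Ψ^F ∘ (C₁ → F_{Φ₁}) ≅ (C₂ → F_{Φ₂}) ∘ Ψ` … Moreover, each of the
composite functors of this diagram is rigid"; Cor. 4.11 (iii) p. 92 "there exists an isomorphism of functors
`Ψ^Φ : Φ₁ ⥲ Φ₂` … lying over the equivalence `Ψ^Base` … which is compatible [when the `C_i` are of isotropic,
but not of group-like type] with the isomorphism `Ψ^Prime` of Theorem 4.2, (ii)"; proof p. 94 "assertion (iii)
follows formally from assertion (ii); Theorem 4.9 … assertion (iv) by concatenating assertions (ii), (iii),
with the fact that `Ψ` preserves Frobenius degrees" [cite: MochizukiFrdI2008, Cor. 4.11 (iv) p.92].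

PROOF-ONLY companion of `DivisorMonoidCategoryTheoreticity.lean` (cell abc-iut, F fact-proving wave, seat
abc-iut-f-033; FACT-LIST rows **F-1029** `PreFrobenioidData.Cor411iv` and **F-1028**
`PreFrobenioidData.Cor411iii_compat`, [FrdI] Corollary 4.11 (iv) / (iii) p. 92), sequel of the same seat's
`DivisorMonoidCategoryTheoreticityCor411ivHolds.lean` / `DivisorMonoidCategoryTheoreticityCor411iiiCompatHolds.lean`
(the route over bases of FSM-type) and the twin of seat abc-iut-f-032's
`DivisorMonoidCategoryTheoreticityCor411iiiAsPrinted.lean` (row F-1027). Both rows are schemas over the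
data-only interfaces (universal closures refuted: `PreFrobenioidData.not_forall_cor411iv`,
`PreFrobenioidData.not_forall_cor411iii_compat`); what print asserts is the instance at THE Frobenioids, THE
Def. 4.5 (iii) parameters and THE data `(Ψ^Base, Ψ^Φ, Ψ^Prime)`. Seat abc-iut-L1-d6's `Cor411AsPrinted.lean`
(`FrdI.cor411ii_ofFunctor`, `FrdI.cor411iv_ofFunctor`, `FrdI.exists_cor411iv_data_ofFunctor`: Thm. 3.4 (ii) as
printed → Cor. 4.11 (ii) → Thm. 4.9 / descent `D^* ⥲ D`) and seat abc-iut-f-027's `Thm49AsPrinted.lean`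
(`FrdI.T49.exists_thm49_compat_ofFunctor`: THE `Ψ^Prime` and THE `Ψ^Φ` with its divisor clause and
`Thm49_compat`) prove these for EVERY pair of Frobenioids with perf-factorial `Φ_i` and EVERY `Ψ`, with NO
hypothesis on `D_i` beyond the typed antecedents (standard type (d): FSMFF), modulo the single input `hrat₁` —
"`C₁` of rational type" read at THE birationalization / THE support predicate. Here, assembled BY NAME with the
FSM-type hypotheses `hD₁ hD₂` of the seat's earlier files DROPPED, nothing re-proved:

* `FrdI.exists_cor411iii_compat_asPrinted` — (iii) WITH its compatibility clause AT THE DATA, for Frobenioids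
  of isotropic, non-group-like type (the clause's own proviso): THE `Ψ^Prime = e` of Thm. 4.2 (ii) (clauses
  (a), (b)), THE `Ψ^Φ = E` of Thm. 4.9 over `Ψ` with its divisor clause on pre-steps and `Thm49_compat E e`,
  THE `1`-unique `Ψ^Base` of (ii) with `η`, the descended `Ψ^Φ'` on `D₁` over `Ψ^Base`
  (`DivisorMonoidIsoOver.exists_overBase`) and bijections of primes `e'` over `Ψ^Base` induced by `e`
  (`DivisorMonoidIsoOver.exists_primes_compat_overBase`), for which the typed `Cor411iii_compat Ψ^Φ' e'`
  holds — the exact conclusion of `FrdI.exists_cor411iii_compat_of_isOfFSMType`, without `hD₁ hD₂`;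
* `PreFrobenioid.cor411iii_compat_holds_asPrinted` — **the instance form of F-1028 AT THE CONSTRUCTIONS, no
  base hypothesis**: "`C₁` of rationally standard type" at `rsParams hF₁ PrimarySupp` supplies `hrat₁`;
* `PreFrobenioid.cor411iv_rsParams_asPrinted` / `PreFrobenioid.cor411iv_holds_asPrinted` — **the instance
  forms of F-1029 AT THE CONSTRUCTIONS, no residual binder, no base hypothesis** (`C₁`'s parameters THE
  constructions and `R₂` arbitrary, resp. both THE constructions);
* `PreFrobenioid.exists_cor411iv_data_asPrinted` — unpacked, for consumers: the data `(Ψ^Base, η, Ψ^Φ)` with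
  the `1`-unique base square, "`Ψ` preserves Frobenius degrees", the divisor formula on ALL arrows, the typed
  rigidity clause `Cor411ivRigid` (row F-1030, at THE data) and the slim-base rigidity clause, under the typed
  antecedents at THE constructions.

Hypotheses: Frobenioids (`IsFrobenioid`) with perf-factorial `Φ_i` (§4 standing hypothesis, Def. 2.4 (i)) —
exactly print's. No definitions; no statement of the paper is restated or strengthened; nothing here is
specific to the abc programme and no side is taken on [IUTchIII] Cor. 3.12.
-/

namespace Literature.AlgebraicGeometry.Frobenioids

open CategoryTheory Opposite

universe w v v' u u'

namespace FrdI

open PreFrobenioid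

variable {D₁ : Type u} [Category.{v} D₁] {Φ₁ : D₁ᵒᵖ ⥤ CommMonCat.{w}} {C₁ : Type u'} [Category.{v'} C₁]
  {D₂ : Type u} [Category.{v} D₂] {Φ₂ : D₂ᵒᵖ ⥤ CommMonCat.{w}} {C₂ : Type u'} [Category.{v'} C₂]
  {F₁ : C₁ ⥤ ElemFrobenioid Φ₁} {F₂ : C₂ ⥤ ElemFrobenioid Φ₂}

set_option backward.isDefEq.respectTransparency false in
/-- **[FrdI] Cor. 4.11 (iii) WITH its compatibility clause (typed `Cor411iii_compat`), in print's generality,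
AT THE DATA — no hypothesis on the base categories** ("compatible [when the `C_i` are of isotropic, but not of
group-like type] with the isomorphism `Ψ^Prime` of Theorem 4.2, (ii)", p. 92): for EVERY pair of Frobenioids
`C_i → F_{Φ_i}` with perf-factorial `Φ_i`, of isotropic and non-group-like type, `C₁` of rational type at THE
birationalization / THE support predicate `PrimarySupp`, and EVERY equivalence `Ψ : C₁ ⥲ C₂` in the setting of
Cor. 4.11 (`Cor411Setting`: Div-slim bases, standard type, hypothesis (b)), there are: THE `Ψ^Prime = e` of
Thm. 4.2 (ii) (clauses (a), (b) on the co-angular pre-steps out of / into each `A`), THE `Ψ^Φ = E : Φ₁ ⥲ Φ₂`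
over `Ψ` of Thm. 4.9 computing `Div(Ψ φ) = Ψ^Φ_A(Div φ)` on pre-steps with its compatibility clause
`Thm49_compat E e` (seat abc-iut-f-027's `FrdI.T49.exists_thm49_compat_ofFunctor`), THE `1`-unique `Ψ^Base`
of (ii) (seat abc-iut-L1-d6's `FrdI.cor411ii_ofFunctor`) with `η : Base₂ ∘ Ψ ≅ Ψ^Base ∘ Base₁`, the descended
`Ψ^Φ'` ON `D₁` over `Ψ^Base` (at `Base A`: `Ψ^Φ_A` followed by `(η_A⁻¹)^*`), and bijections of primes `e'`
over `Ψ^Base` induced by `e`, for which the typed `Cor411iii_compat Ψ^Φ' e'` holds. Twin of the seat's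
`FrdI.exists_cor411iii_compat_of_isOfFSMType` with the FSM-type hypotheses dropped.
[cite: MochizukiFrdI2008, Cor. 4.11 (iii) p.92] -/
theorem exists_cor411iii_compat_asPrinted (hF₁ : IsFrobenioid F₁) (hF₂ : IsFrobenioid F₂)
    (hpf₁ : Objectwise (fun M _ => IsPerfFactorial M) Φ₁) (hpf₂ : Objectwise (fun M _ => IsPerfFactorial M) Φ₂)
    (hrat₁ : ∀ A : C₁, PreFrobenioidData.IsRational
      (biratData hF₁ (hasBiratSquares_of_isFrobenioid hF₁))
      (S := PreFrobenioidData.ofFunctor Φ₁ F₁) (fun a 𝔭 => PrimarySupp a 𝔭) A)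
    (Ψ : C₁ ≌ C₂)
    (histr₁ : (PreFrobenioidData.ofFunctor Φ₁ F₁).IsOfIsotropicType)
    (histr₂ : (PreFrobenioidData.ofFunctor Φ₂ F₂).IsOfIsotropicType)
    (hng₁ : ¬ (PreFrobenioidData.ofFunctor Φ₁ F₁).IsOfGroupLikeType)
    (hng₂ : ¬ (PreFrobenioidData.ofFunctor Φ₂ F₂).IsOfGroupLikeType)
    (hs : (PreFrobenioidData.ofFunctor Φ₁ F₁).Cor411Setting (PreFrobenioidData.ofFunctor Φ₂ F₂) Ψ) :
    ∃ (e : ∀ A : C₁, Primes (Φ₁.obj (op (baseObj F₁ A))) ≃ Primes (Φ₂.obj (op (baseObj F₂ (Ψ.functor.obj A)))))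
      (E : (PreFrobenioidData.ofFunctor Φ₁ F₁).DivisorMonoidIsoOver (PreFrobenioidData.ofFunctor Φ₂ F₂) Ψ)
      (ΨBase : D₁ ⥤ D₂)
      (η : Ψ.functor ⋙ (PreFrobenioidData.ofFunctor Φ₂ F₂).base ≅ (PreFrobenioidData.ofFunctor Φ₁ F₁).base ⋙ ΨBase)
      (E' : (PreFrobenioidData.ofFunctor Φ₁ F₁).DivisorMonoidIsoOverBase (PreFrobenioidData.ofFunctor Φ₂ F₂) ΨBase)
      (e' : ∀ X : D₁, Primes (Φ₁.obj (op X)) ≃ Primes (Φ₂.obj (op (ΨBase.obj X)))),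
      (∀ (A : C₁) (𝔭 : Primes (Φ₁.obj (op (baseObj F₁ A)))),
        (∀ ⦃B : C₁⦄ (φ : A ⟶ B), IsCoAngularPreStep F₁ φ →
            (Div F₁ φ ∈ 𝔭.submonoid ↔ Div F₂ (Ψ.functor.map φ) ∈ (e A 𝔭).submonoid)) ∧
        ∀ ⦃B : C₁⦄ (ψ : B ⟶ A), IsCoAngularPreStep F₁ ψ →
          ((∃ y ∈ 𝔭.submonoid, pull Φ₁ (Base F₁ ψ) y = Div F₁ ψ) ↔
            ∃ y ∈ (e A 𝔭).submonoid, pull Φ₂ (Base F₂ (Ψ.functor.map ψ)) y = Div F₂ (Ψ.functor.map ψ))) ∧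
      (∀ ⦃A B : C₁⦄ (φ : A ⟶ B), IsPreStep F₁ φ → E.iso A (Div F₁ φ) = Div F₂ (Ψ.functor.map φ)) ∧
      (PreFrobenioidData.ofFunctor Φ₁ F₁).Thm49_compat (PreFrobenioidData.ofFunctor Φ₂ F₂) Ψ E e ∧
      PreFrobenioidData.OneUniqueSquare Ψ.functor (PreFrobenioidData.ofFunctor Φ₁ F₁).base
        (PreFrobenioidData.ofFunctor Φ₂ F₂).base ΨBase ∧
      (∀ (A : C₁) (x : Φ₁.obj (op (baseObj F₁ A))), E'.iso (baseObj F₁ A) x = pull Φ₂ (η.inv.app A) (E.iso A x)) ∧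
      (PreFrobenioidData.ofFunctor Φ₁ F₁).Cor411iii_compat (PreFrobenioidData.ofFunctor Φ₂ F₂) E' e' := by
  have hT : PreFrobenioidData.Thm42Setting (PreFrobenioidData.ofFunctor Φ₁ F₁) (PreFrobenioidData.ofFunctor Φ₂ F₂) :=
    ⟨hs.standard, ⟨histr₁, histr₂⟩, ⟨hng₁, hng₂⟩⟩
  -- THE `Ψ^Prime` and THE `Ψ^Φ` with its divisor clause and compatibility, at the `C`-level (Thm. 4.9 as printed)
  obtain ⟨E, e, he, hE, hcompat⟩ := T49.exists_thm49_compat_ofFunctor hF₁ hF₂ hpf₁ hpf₂ hrat₁ Ψ hT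
  -- THE `Ψ^Base` of Cor. 4.11 (ii) as printed
  obtain ⟨ΨBase, hsq, -⟩ := cor411ii_ofFunctor hF₁ hF₂ Ψ hpf₁ hpf₂ hs
  obtain ⟨η⟩ := hsq.2.1
  -- descent `D^* ⥲ D`
  obtain ⟨E', hE'⟩ := E.exists_overBase ΨBase η (exists_base_iso_of_isFrobenioid F₁ hF₁)
    (exists_preSteps_of_base_iso F₁ hF₁) (fun A _ f => exists_arrow_over_base F₁ hF₁ A f)
  obtain ⟨e', he'⟩ := E.exists_primes_compat_overBase e ΨBase η E' hE' (exists_base_iso_of_isFrobenioid F₁ hF₁)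
  exact ⟨e, E, ΨBase, η, E', e', he, hE, hcompat, hsq, hE',
    fun h₁ h₂ h₃ h₄ X 𝔭 x => he' (fun A 𝔭 x => hcompat h₁ h₂ h₃ h₄ A 𝔭 x) X 𝔭 x⟩

end FrdI

namespace PreFrobenioid

variable {D₁ : Type u} [Category.{v} D₁] {Φ₁ : D₁ᵒᵖ ⥤ CommMonCat.{w}} {C₁ : Type u'} [Category.{v'} C₁]
  {D₂ : Type u} [Category.{v} D₂] {Φ₂ : D₂ᵒᵖ ⥤ CommMonCat.{w}} {C₂ : Type u'} [Category.{v'} C₂]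
  {F₁ : C₁ ⥤ ElemFrobenioid Φ₁} {F₂ : C₂ ⥤ ElemFrobenioid Φ₂}

/-! ### Cor. 4.11 (iii), compatibility clause — row F-1028 at THE constructions -/

set_option backward.isDefEq.respectTransparency false in
/-- **[FrdI] Corollary 4.11 (iii), compatibility clause — FACT-LIST row F-1028
`PreFrobenioidData.Cor411iii_compat`, the instance form AT THE CONSTRUCTIONS, in print's generality, no base
hypothesis** (p. 92): for EVERY pair of Frobenioids `C_i → F_{Φ_i}` (Def. 1.3) with `Φ_i` perf-factorial (§4),
of isotropic and non-group-like type (the clause's proviso "when the `C_i` are of isotropic, but not of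
group-like type"), `C₁` of rationally standard type at ITS Def. 4.5 (iii) parameters `rsParams hF₁ PrimarySupp`
(THE birationalization of Prop. 4.4, THE unit-trivialisation of Prop. 3.3 (iv), THE support predicate of
Def. 2.4 (i)(d)), and EVERY equivalence `Ψ : C₁ ⥲ C₂` in the setting of Cor. 4.11: THE `Ψ^Prime = e` of
Thm. 4.2 (ii), THE `Ψ^Φ = E` of Thm. 4.9 with its divisor clause and `Thm49_compat E e`, THE `Ψ^Base` of (ii)
with `η`, the descended `Ψ^Φ'` on `D₁` over `Ψ^Base` and the bijections of primes `e'` over `Ψ^Base` induced by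
`e` exist, and the typed `Cor411iii_compat Ψ^Φ' e'` holds — `Ψ^Φ'_X` maps `Φ₁(X)_𝔭` onto
`Φ₂(Ψ^Base X)_{e'_X(𝔭)}`. The antecedent "rationally standard" supplies "`C₁` of rational type"
(Def. 4.5 (iii)(a)) at THE constructions, the residual input `hrat₁` of `FrdI.exists_cor411iii_compat_asPrinted`.
[cite: MochizukiFrdI2008, Cor. 4.11 (iii) p.92] -/
theorem cor411iii_compat_holds_asPrinted (hF₁ : IsFrobenioid F₁) (hF₂ : IsFrobenioid F₂)
    (hpf₁ : Objectwise (fun M _ => IsPerfFactorial M) Φ₁) (hpf₂ : Objectwise (fun M _ => IsPerfFactorial M) Φ₂)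
    (Ψ : C₁ ≌ C₂)
    (histr₁ : (PreFrobenioidData.ofFunctor Φ₁ F₁).IsOfIsotropicType)
    (histr₂ : (PreFrobenioidData.ofFunctor Φ₂ F₂).IsOfIsotropicType)
    (hng₁ : ¬ (PreFrobenioidData.ofFunctor Φ₁ F₁).IsOfGroupLikeType)
    (hng₂ : ¬ (PreFrobenioidData.ofFunctor Φ₂ F₂).IsOfGroupLikeType)
    (hR₁ : (PreFrobenioidData.ofFunctor Φ₁ F₁).IsOfRationallyStandardType (rsParams hF₁ fun a 𝔭 => PrimarySupp a 𝔭))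
    (hs : (PreFrobenioidData.ofFunctor Φ₁ F₁).Cor411Setting (PreFrobenioidData.ofFunctor Φ₂ F₂) Ψ) :
    ∃ (e : ∀ A : C₁, Primes (Φ₁.obj (op (baseObj F₁ A))) ≃ Primes (Φ₂.obj (op (baseObj F₂ (Ψ.functor.obj A)))))
      (E : (PreFrobenioidData.ofFunctor Φ₁ F₁).DivisorMonoidIsoOver (PreFrobenioidData.ofFunctor Φ₂ F₂) Ψ)
      (ΨBase : D₁ ⥤ D₂)
      (η : Ψ.functor ⋙ (PreFrobenioidData.ofFunctor Φ₂ F₂).base ≅ (PreFrobenioidData.ofFunctor Φ₁ F₁).base ⋙ ΨBase)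
      (E' : (PreFrobenioidData.ofFunctor Φ₁ F₁).DivisorMonoidIsoOverBase (PreFrobenioidData.ofFunctor Φ₂ F₂) ΨBase)
      (e' : ∀ X : D₁, Primes (Φ₁.obj (op X)) ≃ Primes (Φ₂.obj (op (ΨBase.obj X)))),
      (∀ (A : C₁) (𝔭 : Primes (Φ₁.obj (op (baseObj F₁ A)))),
        (∀ ⦃B : C₁⦄ (φ : A ⟶ B), IsCoAngularPreStep F₁ φ →
            (Div F₁ φ ∈ 𝔭.submonoid ↔ Div F₂ (Ψ.functor.map φ) ∈ (e A 𝔭).submonoid)) ∧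
        ∀ ⦃B : C₁⦄ (ψ : B ⟶ A), IsCoAngularPreStep F₁ ψ →
          ((∃ y ∈ 𝔭.submonoid, pull Φ₁ (Base F₁ ψ) y = Div F₁ ψ) ↔
            ∃ y ∈ (e A 𝔭).submonoid, pull Φ₂ (Base F₂ (Ψ.functor.map ψ)) y = Div F₂ (Ψ.functor.map ψ))) ∧
      (∀ ⦃A B : C₁⦄ (φ : A ⟶ B), IsPreStep F₁ φ → E.iso A (Div F₁ φ) = Div F₂ (Ψ.functor.map φ)) ∧
      (PreFrobenioidData.ofFunctor Φ₁ F₁).Thm49_compat (PreFrobenioidData.ofFunctor Φ₂ F₂) Ψ E e ∧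
      PreFrobenioidData.OneUniqueSquare Ψ.functor (PreFrobenioidData.ofFunctor Φ₁ F₁).base
        (PreFrobenioidData.ofFunctor Φ₂ F₂).base ΨBase ∧
      (∀ (A : C₁) (x : Φ₁.obj (op (baseObj F₁ A))), E'.iso (baseObj F₁ A) x = pull Φ₂ (η.inv.app A) (E.iso A x)) ∧
      (PreFrobenioidData.ofFunctor Φ₁ F₁).Cor411iii_compat (PreFrobenioidData.ofFunctor Φ₂ F₂) E' e' :=
  FrdI.exists_cor411iii_compat_asPrinted hF₁ hF₂ hpf₁ hpf₂ (fun A => hR₁.rational A) Ψ histr₁ histr₂ hng₁ hng₂ hs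

/-! ### Cor. 4.11 (iv) — row F-1029 at THE constructions -/

set_option backward.isDefEq.respectTransparency false in
/-- **[FrdI] Cor. 4.11 (iv) AS TYPED, in print's generality, `C₁`'s Def. 4.5 (iii) parameters THE
constructions, `R₂` arbitrary — no residual binder, no base hypothesis** (Category-theoreticity of the functor
to an elementary Frobenioid I, p. 92): for EVERY pair of Frobenioids `C_i → F_{Φ_i}` with perf-factorial `Φ_i`
and EVERY equivalence `Ψ : C₁ ⥲ C₂`, the typed Cor. 4.11 (iv) holds at the parameters `rsParams hF₁ PrimarySupp`
of `C₁` (THE birationalization `C₁^birat` of Prop. 4.4, THE unit-trivialisation `C₁^un-tr` of Prop. 3.3 (iv)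
with ITS birationalization, THE support predicate of Def. 2.4 (i)(d)) and arbitrary parameters `R₂` of `C₂`:
if `D_i` are Div-slim, `C_i` of standard type with hypothesis (b), and `C_i` of rationally standard type, then
there are `Ψ^Base : D₁ ⥲ D₂`, `Ψ^Φ : Φ₁ ⥲ Φ₂` over it and `η : Base₂ ∘ Ψ ≅ Ψ^Base ∘ Base₁` with `Ψ` preserving
Frobenius degrees and `Div(Ψ φ) = η_A^* Ψ^Φ(Div φ)` for every `φ : A → B` — the `1`-commutative diagram
`Ψ^F ∘ (C₁ → F_{Φ₁}) ≅ (C₂ → F_{Φ₂}) ∘ Ψ` — and, for slim `D_i`, rigid `D`-valued composites. Seat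
abc-iut-L1-d6's `FrdI.cor411iv_ofFunctor` with its `hrat₁` ("`C₁` of rational type", Def. 4.5 (iii)(a))
supplied by the `rational` field of the antecedent; twin of the seat's `cor411iv_holds_of_isOfFSMType` with
the FSM-type hypotheses dropped. [cite: MochizukiFrdI2008, Cor. 4.11 (iv) p.92] -/
theorem cor411iv_rsParams_asPrinted (hF₁ : IsFrobenioid F₁) (hF₂ : IsFrobenioid F₂)
    (hpf₁ : Objectwise (fun M _ => IsPerfFactorial M) Φ₁) (hpf₂ : Objectwise (fun M _ => IsPerfFactorial M) Φ₂)
    (Ψ : C₁ ≌ C₂) (R₂ : (PreFrobenioidData.ofFunctor Φ₂ F₂).RSParams) :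
    (PreFrobenioidData.ofFunctor Φ₁ F₁).Cor411iv (PreFrobenioidData.ofFunctor Φ₂ F₂) Ψ
      (rsParams hF₁ fun a 𝔭 => PrimarySupp a 𝔭) R₂ := fun hs hR₁ hR₂ =>
  FrdI.cor411iv_ofFunctor hF₁ hF₂ hpf₁ hpf₂ (fun A => hR₁.rational A) Ψ _ R₂ hs hR₁ hR₂

set_option backward.isDefEq.respectTransparency false in
/-- **[FrdI] Cor. 4.11 (iv) AS TYPED, in print's generality, AT THE CONSTRUCTIONS — the instance form of
FACT-LIST row F-1029 with no residual binder and no base hypothesis** (the shape in which the cone quotes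
Def. 4.5 (iii): `C₁`, `C₂` of rationally standard type for THEIR birationalizations, unit-trivialisations and
THE support predicate): both parameter packages are THE constructions `rsParams hF_i PrimarySupp`.
[cite: MochizukiFrdI2008, Cor. 4.11 (iv) p.92] -/
theorem cor411iv_holds_asPrinted (hF₁ : IsFrobenioid F₁) (hF₂ : IsFrobenioid F₂)
    (hpf₁ : Objectwise (fun M _ => IsPerfFactorial M) Φ₁) (hpf₂ : Objectwise (fun M _ => IsPerfFactorial M) Φ₂)
    (Ψ : C₁ ≌ C₂) :
    (PreFrobenioidData.ofFunctor Φ₁ F₁).Cor411iv (PreFrobenioidData.ofFunctor Φ₂ F₂) Ψ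
      (rsParams hF₁ fun a 𝔭 => PrimarySupp a 𝔭) (rsParams hF₂ fun a 𝔭 => PrimarySupp a 𝔭) :=
  cor411iv_rsParams_asPrinted hF₁ hF₂ hpf₁ hpf₂ Ψ _

set_option backward.isDefEq.respectTransparency false in
/-- **Unpacked form for consumers, AT THE CONSTRUCTIONS, no base hypothesis** ("a 1-commutative diagram …
Moreover, each of the composite functors of this diagram is rigid", p. 92): for EVERY pair of Frobenioids with
perf-factorial `Φ_i` and EVERY `Ψ`, under `Cor411Setting` and "`C₁` of rationally standard type" at THE
constructions `rsParams hF₁ PrimarySupp`, there are THE data `(Ψ^Base, η, Ψ^Φ)` of Cor. 4.11 (iv): the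
`1`-unique base square of (ii), "`Ψ` preserves Frobenius degrees", the divisor formula
`Div(Ψ φ) = η_A^* Ψ^Φ(Div φ)` on ALL arrows, the typed rigidity clause `Cor411ivRigid` (row F-1030) at THIS
data, and the slim-base rigidity clause of (ii). Seat abc-iut-L1-d6's `FrdI.exists_cor411iv_data_ofFunctor`
with `hrat₁` supplied by the antecedent. [cite: MochizukiFrdI2008, Cor. 4.11 (iv) p.92] -/
theorem exists_cor411iv_data_asPrinted (hF₁ : IsFrobenioid F₁) (hF₂ : IsFrobenioid F₂)
    (hpf₁ : Objectwise (fun M _ => IsPerfFactorial M) Φ₁) (hpf₂ : Objectwise (fun M _ => IsPerfFactorial M) Φ₂)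
    (Ψ : C₁ ≌ C₂)
    (hs : (PreFrobenioidData.ofFunctor Φ₁ F₁).Cor411Setting (PreFrobenioidData.ofFunctor Φ₂ F₂) Ψ)
    (hR₁ : (PreFrobenioidData.ofFunctor Φ₁ F₁).IsOfRationallyStandardType
      (rsParams hF₁ fun a 𝔭 => PrimarySupp a 𝔭)) :
    ∃ (ΨBase : D₁ ⥤ D₂)
      (E' : (PreFrobenioidData.ofFunctor Φ₁ F₁).DivisorMonoidIsoOverBase (PreFrobenioidData.ofFunctor Φ₂ F₂) ΨBase)
      (η : Ψ.functor ⋙ (PreFrobenioidData.ofFunctor Φ₂ F₂).base ≅ (PreFrobenioidData.ofFunctor Φ₁ F₁).base ⋙ ΨBase),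
      PreFrobenioidData.OneUniqueSquare Ψ.functor (PreFrobenioidData.ofFunctor Φ₁ F₁).base
        (PreFrobenioidData.ofFunctor Φ₂ F₂).base ΨBase ∧
      PreFrobenioidData.PreservesDegFr (PreFrobenioidData.ofFunctor Φ₁ F₁) (PreFrobenioidData.ofFunctor Φ₂ F₂) Ψ ∧
      (∀ ⦃A B : C₁⦄ (φ : A ⟶ B),
        Div F₂ (Ψ.functor.map φ) = pull Φ₂ (η.hom.app A) (E'.iso (baseObj F₁ A) (Div F₁ φ))) ∧
      (PreFrobenioidData.ofFunctor Φ₁ F₁).Cor411ivRigid (PreFrobenioidData.ofFunctor Φ₂ F₂) Ψ ΨBase E' ∧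
      (IsSlim D₁ → IsSlim D₂ → IsRigidFunctor (Ψ.functor ⋙ (PreFrobenioidData.ofFunctor Φ₂ F₂).base) ∧
        IsRigidFunctor ((PreFrobenioidData.ofFunctor Φ₁ F₁).base ⋙ ΨBase)) :=
  FrdI.exists_cor411iv_data_ofFunctor hF₁ hF₂ hpf₁ hpf₂ (fun A => hR₁.rational A) Ψ hs

end PreFrobenioid

end Literature.AlgebraicGeometry.Frobenioids
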